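import Mathlib
import HarnessLib
import Summits.NavierStokesRegularity.NavierStokesRegularity.Theorems.PoloidalWindowDoorPoloidalWindowRigidityThreadShearHessian
import Summits.NavierStokesRegularity.NavierStokesRegularity.Theorems.PoloidalWindowDoorPoloidalWindowRigidityThreadNoXPoint
import Summits.NavierStokesRegularity.NavierStokesRegularity.Theorems.PoloidalWindowDoorPoloidalWindowRigidityClebsch
import Summits.NavierStokesRegularity.NavierStokesRegularity.Theorems.PoloidalWindowDoorPoloidalWindowRigidityFirstIntegral

/-!
# Route `PoloidalWindowDoor`, crux `PoloidalWindowRigidity` (K2, stmt-NavierStokesRegularity-19708) — THE CENTRE IS A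
# STRICT PLANAR EXTREMUM OF THE STREAM FUNCTION: part C of stub Z1 `stub_threadZeroStructure` (line `centre_type` v4,
# ns-idea-8 g6), and the Clebsch package at a thread shared by parts B and C

Cell ns-regularity-ideate, seat ns-poloidal-K2-p2 g11 (stub-worker on K2; `--supports` the crux item).

* `clebsch_thread_package` — for the slice `v(−1)` of a poloidal profile of the route's Type-I class with the thread pin
  `∇v₂(−1,0) = 0` and the loop-tangency pins `∂_z v_h(−1,0) = 0`: Clebsch potentials `φ ∈ C^∞`, `ψ ∈ C²` of the slice
  (`v_h = ∇_hφ`, `v₂ = ∂₂φ + ψ`, tree `…Clebsch.exists_clebsch_slice`), the frozen bracket `{ψ, v₂} = 0`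
  (`…Clebsch.frozen_bracket` fed by `…FirstIntegral.stub_firstIntegral`), `∇_hψ(0) = 0`, and the horizontal Hessian of
  `ψ` at `0` = `H − M` (`H_ab = ∂_b∂_a v₂(−1,0)`, `M_ab = ∂_b∂_z v_a(−1,0)`), entrywise as nested `fderiv`s;
* `exists_ball_lt_of_posDef` — a `C²` function on `ℝ³` with vanishing horizontal gradient and POSITIVE DEFINITE horizontal
  Hessian at `0` has a strict minimum at `0` along the punctured horizontal plane near `0` (second-order sufficient
  condition along rays: little-o of the first partials + monotonicity);
* `strictPlanarExtremum_of_det_pos` — definite horizontal Hessian (`det > 0`) ⇒ strict planar extremum, in the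
  `nhdsWithin` form of `Theses/LoopPeriodRatchet.lean: NoPlanarExtremum` (`y₀ = 0`);
* `centre_strictExtremum` — PART C at class level: if `det(H − M) > 0` then `ψ = v₂ − ∂₂Φ` (`Φ := φ`) has a strict planar
  extremum at the thread, stated exactly as conjunct (v) of `stub_threadZeroStructure`.

WHAT THIS IS NOT: not a claim about Navier–Stokes regularity, not K2/I2 — calculus at the hot spot of a HYPOTHETICAL poloidal
Type-I blow-up profile for one provable stub of an ideator line (bears_on LADDER-NS N0, rung N0-LocalTubeDoorPoloidal).
-/

noncomputable section

-- the summit and its single sub-problem share the name (CONVENTIONS §1), as in every Theorems file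
set_option linter.dupNamespace false

namespace Summit.NavierStokesRegularity.NavierStokesRegularity.Theorems.PoloidalWindowDoorPoloidalWindowRigidityThreadCentreExtremum

open MeasureTheory Set Function Filter Topology Metric
open scoped RealInnerProductSpace InnerProductSpace
open Literature.Analysis Literature.Analysis.FluidPDE
open Summit.NavierStokesRegularity.NavierStokesRegularity.Theorems.PoloidalWindowDoorPoloidalWindowRigidityConstantShearMeans
open Summit.NavierStokesRegularity.NavierStokesRegularity.Theorems.PoloidalWindowDoorPoloidalWindowRigidityWindow
open Summit.NavierStokesRegularity.NavierStokesRegularity.Theorems.PoloidalWindowDoorPoloidalWindowRigidityFirstIntegral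
open Summit.NavierStokesRegularity.NavierStokesRegularity.Theorems.PoloidalWindowDoorPoloidalWindowRigidityClebsch
open Summit.NavierStokesRegularity.NavierStokesRegularity.Theorems.PoloidalWindowDoorLrcModEntireMorseLevelRays
open Summit.NavierStokesRegularity.NavierStokesRegularity.Theorems.PoloidalWindowDoorPoloidalWindowRigidityThreadShearHessian
open Summit.NavierStokesRegularity.NavierStokesRegularity.Theorems.PoloidalWindowDoorPoloidalWindowRigidityThreadNoXPoint

/-! ### The Clebsch package at a thread -/

/-- **Clebsch package at a thread.**  For the slice `v(−1)` of a poloidal profile of the route's Type-I class with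
`∇v₂(−1,0) = 0` and `∂_z v₀(−1,0) = ∂_z v₁(−1,0) = 0`: potentials `φ, ψ` with `∂₀φ = v₀`, `∂₁φ = v₁`, `v₂ = ∂₂φ + ψ`, the
frozen bracket `∂₁ψ·∂₀v₂ − ∂₀ψ·∂₁v₂ ≡ 0`, the vanishing of `∇_hψ(0)`, and the horizontal Hessian of `ψ` at `0` expressed
through `H − M`. -/
theorem clebsch_thread_package {C : ℝ} {v : ℝ → EuclideanSpace ℝ (Fin 3) → EuclideanSpace ℝ (Fin 3)}
    (hrate : HasTypeITimeDecay C v)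
    (hcont : ContinuousOn (uncurry v) (Iio (0 : ℝ) ×ˢ univ))
    (hmild : ∀ s t : ℝ, s < t → t < 0 → ∀ x,
      v t x = UnboundedOperators.heatExtension (v s) (t - s) x - oseenDuhamel 1 s v v t x)
    (hdiv : ∀ t < 0, VectorCalculus.IsDivFree (v t))
    (hpol : ∀ s < 0, ∀ y, ⟪curl (v s) y, EuclideanSpace.single 2 1⟫_ℝ = 0)
    (hgrad : ∀ h : EuclideanSpace ℝ (Fin 3), fderiv ℝ (v (-1)) 0 h 2 = 0)
    (hpin : fderiv ℝ (v (-1)) 0 (EuclideanSpace.single 2 1) 0 = 0 ∧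
      fderiv ℝ (v (-1)) 0 (EuclideanSpace.single 2 1) 1 = 0) :
    ∃ φ ψ : EuclideanSpace ℝ (Fin 3) → ℝ, ContDiff ℝ 2 φ ∧ ContDiff ℝ 2 ψ ∧
      (∀ y, v (-1) y 0 = fderiv ℝ φ y (EuclideanSpace.single 0 1) ∧
        v (-1) y 1 = fderiv ℝ φ y (EuclideanSpace.single 1 1)) ∧
      (∀ y, v (-1) y 2 - fderiv ℝ φ y (EuclideanSpace.single 2 1) = ψ y) ∧
      (∀ y, fderiv ℝ ψ y (EuclideanSpace.single 1 1) * fderiv ℝ (v (-1)) y (EuclideanSpace.single 0 1) 2 -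
        fderiv ℝ ψ y (EuclideanSpace.single 0 1) * fderiv ℝ (v (-1)) y (EuclideanSpace.single 1 1) 2 = 0) ∧
      (∀ t u : ℝ, fderiv ℝ ψ 0 (t • EuclideanSpace.single 0 1 + u • EuclideanSpace.single 1 1) = 0) ∧
      (∀ w, fderiv ℝ (fun y => fderiv ℝ ψ y (EuclideanSpace.single 0 1)) 0 w =
        fderiv ℝ (fun y => fderiv ℝ (v (-1)) y (EuclideanSpace.single 0 1) 2) 0 w -
          fderiv ℝ (fun y => fderiv ℝ (v (-1)) y (EuclideanSpace.single 2 1) 0) 0 w) ∧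
      (∀ w, fderiv ℝ (fun y => fderiv ℝ ψ y (EuclideanSpace.single 1 1)) 0 w =
        fderiv ℝ (fun y => fderiv ℝ (v (-1)) y (EuclideanSpace.single 1 1) 2) 0 w -
          fderiv ℝ (fun y => fderiv ℝ (v (-1)) y (EuclideanSpace.single 2 1) 1) 0 w) := by
  have hA : IsTypeIAncientMild C v := isTypeIAncientMild_of_class hrate hcont hmild hdiv
  have hvs : ContDiff ℝ (⊤ : ℕ∞) (v (-1)) := hA.contDiff_slice (by norm_num)
  have hV2 : ContDiff ℝ 2 (v (-1)) := contDiff_infty.1 hvs 2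
  have hV21 : ContDiff ℝ ((1 : ℕ∞) + 1) (v (-1)) := by exact_mod_cast hV2
  obtain ⟨φ, ψ, hφs, hψs, h0c, h1c, h2c, -, hcomp, -, -, -⟩ :=
    exists_clebsch_slice hrate hcont hmild hdiv hpol (s := -1) (by norm_num)
  have hφ2 : ContDiff ℝ 2 φ := contDiff_infty.1 hφs 2
  have hψ2 : ContDiff ℝ 2 ψ := contDiff_infty.1 hψs 2
  have hfi : ∀ y, ⟪fderiv ℝ (v (-1)) y (curl (v (-1)) y), EuclideanSpace.single 2 1⟫_ℝ = 0 := fun y =>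
    stub_firstIntegral C v hrate hcont hmild hdiv (EuclideanSpace.single 2 1) hpol (-1) (by norm_num) y
  -- `∇_hψ = ∇_hv₂ − ∂_zv_h`
  have hA0 : ∀ y, fderiv ℝ ψ y (EuclideanSpace.single 0 1) =
      fderiv ℝ (v (-1)) y (EuclideanSpace.single 0 1) 2 - fderiv ℝ (v (-1)) y (EuclideanSpace.single 2 1) 0 :=
    fun y => by
    have h := (hcomp y).2.1
    have c1 : curl (v (-1)) y 1 = fderiv ℝ (v (-1)) y (EuclideanSpace.single 2 1) 0 -
        fderiv ℝ (v (-1)) y (EuclideanSpace.single 0 1) 2 := by simp [curl]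
    linarith
  have hA1 : ∀ y, fderiv ℝ ψ y (EuclideanSpace.single 1 1) =
      fderiv ℝ (v (-1)) y (EuclideanSpace.single 1 1) 2 - fderiv ℝ (v (-1)) y (EuclideanSpace.single 2 1) 1 :=
    fun y => by
    have h := (hcomp y).1
    have c0 : curl (v (-1)) y 0 = fderiv ℝ (v (-1)) y (EuclideanSpace.single 1 1) 2 -
        fderiv ℝ (v (-1)) y (EuclideanSpace.single 2 1) 1 := by simp [curl]
    linarith
  have hdq : ∀ a : Fin 3, Differentiable ℝ fun y => fderiv ℝ (v (-1)) y (EuclideanSpace.single a 1) 2 :=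
    fun a => (contDiff_fderiv_apply_coord hV21 _ 2).differentiable one_ne_zero
  have hdp : ∀ a : Fin 3, Differentiable ℝ fun y => fderiv ℝ (v (-1)) y (EuclideanSpace.single 2 1) a :=
    fun a => (contDiff_fderiv_apply_coord hV21 _ a).differentiable one_ne_zero
  refine ⟨φ, ψ, hφ2, hψ2, fun y => ⟨(h0c y).symm, (h1c y).symm⟩, fun y => by rw [h2c y]; ring,
    fun y => frozen_bracket hfi hcomp y, fun t u => ?_, fun w => ?_, fun w => ?_⟩
  · rw [map_add, map_smul, map_smul, hA0, hA1, hgrad, hgrad, hpin.1, hpin.2]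
    simp
  · rw [show (fun y => fderiv ℝ ψ y (EuclideanSpace.single 0 1)) =
        fun y => fderiv ℝ (v (-1)) y (EuclideanSpace.single 0 1) 2 -
          fderiv ℝ (v (-1)) y (EuclideanSpace.single 2 1) 0 from funext hA0,
      fderiv_fun_sub ((hdq 0) 0) ((hdp 0) 0), _root_.sub_apply]
  · rw [show (fun y => fderiv ℝ ψ y (EuclideanSpace.single 1 1)) =
        fun y => fderiv ℝ (v (-1)) y (EuclideanSpace.single 1 1) 2 -
          fderiv ℝ (v (-1)) y (EuclideanSpace.single 2 1) 1 from funext hA1,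
      fderiv_fun_sub ((hdq 1) 0) ((hdp 1) 0), _root_.sub_apply]

/-! ### Second-order sufficient condition along the horizontal plane -/

variable {g : EuclideanSpace ℝ (Fin 3) → ℝ}

/-- A horizontal vector is the combination of `e₀, e₁` with its own coordinates. -/
theorem eq_smul_add_smul_of_apply_two {y : EuclideanSpace ℝ (Fin 3)} (hy : y 2 = 0) :
    y = y 0 • EuclideanSpace.single 0 1 + y 1 • EuclideanSpace.single 1 1 := by
  ext i
  fin_cases i <;> simp [hy]

/-- `‖y‖² = y₀² + y₁²` for a horizontal vector. -/
theorem norm_sq_of_apply_two {y : EuclideanSpace ℝ (Fin 3)} (hy : y 2 = 0) : ‖y‖ ^ 2 = y 0 ^ 2 + y 1 ^ 2 := by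
  rw [EuclideanSpace.norm_sq_eq, Fin.sum_univ_three]
  simp [hy]

/-- **Strict planar minimum from a positive definite horizontal Hessian.**  `g ∈ C²(ℝ³)` with `∂₀g(0) = ∂₁g(0) = 0`,
`∂₀∂₀g(0) > 0` and `∂₀∂₀g(0)·∂₁∂₁g(0) − ∂₁∂₀g(0)·∂₀∂₁g(0) > 0` (nested-`fderiv` entries).  Then `g 0 < g y` for every
horizontal `y ≠ 0` in a ball. -/
theorem exists_ball_lt_of_posDef (hg : ContDiff ℝ 2 g)
    (h0 : fderiv ℝ g 0 (EuclideanSpace.single 0 1) = 0) (h1 : fderiv ℝ g 0 (EuclideanSpace.single 1 1) = 0)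
    (hp : 0 < fderiv ℝ (fun y => fderiv ℝ g y (EuclideanSpace.single 0 1)) 0 (EuclideanSpace.single 0 1))
    (hdet : 0 < fderiv ℝ (fun y => fderiv ℝ g y (EuclideanSpace.single 0 1)) 0 (EuclideanSpace.single 0 1) *
        fderiv ℝ (fun y => fderiv ℝ g y (EuclideanSpace.single 1 1)) 0 (EuclideanSpace.single 1 1) -
      fderiv ℝ (fun y => fderiv ℝ g y (EuclideanSpace.single 0 1)) 0 (EuclideanSpace.single 1 1) *
        fderiv ℝ (fun y => fderiv ℝ g y (EuclideanSpace.single 1 1)) 0 (EuclideanSpace.single 0 1)) :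
    ∃ ρ > 0, ∀ y : EuclideanSpace ℝ (Fin 3), y 2 = 0 → y ≠ 0 → ‖y‖ < ρ → g 0 < g y := by
  have hgd : Differentiable ℝ g := hg.differentiable two_ne_zero
  have hsym : fderiv ℝ (fun y => fderiv ℝ g y (EuclideanSpace.single 0 1)) 0 (EuclideanSpace.single 1 1) =
      fderiv ℝ (fun y => fderiv ℝ g y (EuclideanSpace.single 1 1)) 0 (EuclideanSpace.single 0 1) :=
    fderiv_fderiv_symm hg 0 _ _
  -- name the entries
  generalize hP : fderiv ℝ (fun y => fderiv ℝ g y (EuclideanSpace.single 0 1)) 0 = P at hp hdet hsym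
  generalize hR : fderiv ℝ (fun y => fderiv ℝ g y (EuclideanSpace.single 1 1)) 0 = R at hdet hsym
  set p := P (EuclideanSpace.single 0 1) with hp_def
  set q := P (EuclideanSpace.single 1 1) with hq_def
  set r := R (EuclideanSpace.single 1 1) with hr_def
  rw [← hsym] at hdet
  have hr : 0 < r := by nlinarith [sq_nonneg q]
  set lam : ℝ := (p * r - q * q) / (p + r) with hlam_def
  have hlam : 0 < lam := div_pos hdet (by linarith)
  -- the quadratic form dominates `lam·|y|²`
  have hQ : ∀ a b : ℝ, lam * (a ^ 2 + b ^ 2) ≤ p * a ^ 2 + 2 * q * a * b + r * b ^ 2 := by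
    intro a b
    rw [hlam_def, div_mul_eq_mul_div, div_le_iff₀ (by linarith)]
    nlinarith [sq_nonneg (p * a + q * b), sq_nonneg (q * a + r * b)]
  -- little-o of the first partials
  set ε : ℝ := lam / 8 with hε_def
  have hε : 0 < ε := by positivity
  obtain ⟨ρ₀, hρ₀, hball₀⟩ := exists_ball_fderiv_apply_sub_le hg (EuclideanSpace.single 0 1) hε
  obtain ⟨ρ₁, hρ₁, hball₁⟩ := exists_ball_fderiv_apply_sub_le hg (EuclideanSpace.single 1 1) hε
  refine ⟨min ρ₀ ρ₁, lt_min hρ₀ hρ₁, fun y hy2 hy0 hyρ => ?_⟩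
  have hyρ0 : ‖y‖ < ρ₀ := lt_of_lt_of_le hyρ (min_le_left _ _)
  have hyρ1 : ‖y‖ < ρ₁ := lt_of_lt_of_le hyρ (min_le_right _ _)
  have hny : 0 < ‖y‖ := norm_pos_iff.2 hy0
  have hdec := eq_smul_add_smul_of_apply_two hy2
  have hnsq := norm_sq_of_apply_two hy2
  have ha0 : |y 0| ≤ ‖y‖ := abs_apply_le_norm y 0
  have ha1 : |y 1| ≤ ‖y‖ := abs_apply_le_norm y 1
  -- the ray function and its derivative
  set G : ℝ → ℝ := fun τ => g (τ • y) with hG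
  have hGd : ∀ τ, HasDerivAt G (fderiv ℝ g (τ • y) y) τ := fun τ => hasDerivAt_axis hgd y τ
  -- lower bound for the derivative on `[0, 1]`
  have hG' : ∀ τ : ℝ, 0 ≤ τ → τ ≤ 1 → 3 * lam / 4 * ‖y‖ ^ 2 * τ ≤ fderiv ℝ g (τ • y) y := by
    intro τ hτ0 hτ1
    have hτy : ‖τ • y‖ = τ * ‖y‖ := by rw [norm_smul, Real.norm_eq_abs, abs_of_nonneg hτ0]
    have hτρ0 : ‖τ • y‖ < ρ₀ := by rw [hτy]; nlinarith
    have hτρ1 : ‖τ • y‖ < ρ₁ := by rw [hτy]; nlinarith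
    have e0 := hball₀ (τ • y) hτρ0
    have e1 := hball₁ (τ • y) hτρ1
    rw [h0, sub_zero, hτy, hP, map_smul, smul_eq_mul] at e0
    rw [h1, sub_zero, hτy, hR, map_smul, smul_eq_mul] at e1
    -- `P y = y₀ p + y₁ q`, `R y = y₀ q + y₁ r`
    have hPy : P y = y 0 * p + y 1 * q := by
      conv_lhs => rw [hdec]
      rw [map_add, map_smul, map_smul, smul_eq_mul, smul_eq_mul]
    have hRy : R y = y 0 * q + y 1 * r := by
      conv_lhs => rw [hdec]
      rw [map_add, map_smul, map_smul, smul_eq_mul, smul_eq_mul, hsym]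
    rw [hPy] at e0
    rw [hRy] at e1
    -- the directional derivative in terms of the two partials
    have hDy : fderiv ℝ g (τ • y) y = y 0 * fderiv ℝ g (τ • y) (EuclideanSpace.single 0 1) +
        y 1 * fderiv ℝ g (τ • y) (EuclideanSpace.single 1 1) := by
      have h := congrArg (fderiv ℝ g (τ • y)) hdec
      rw [map_add, map_smul, map_smul, smul_eq_mul, smul_eq_mul] at h
      exact h
    rw [hDy]
    have hQy := hQ (y 0) (y 1)
    rw [← hnsq] at hQy
    -- signed products
    generalize hX0 : fderiv ℝ g (τ • y) (EuclideanSpace.single 0 1) = X0 at e0 ⊢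
    generalize hX1 : fderiv ℝ g (τ • y) (EuclideanSpace.single 1 1) = X1 at e1 ⊢
    have k0 : y 0 * (τ * (y 0 * p + y 1 * q)) - ‖y‖ * (ε * (τ * ‖y‖)) ≤ y 0 * X0 := by
      have h3 : |y 0 * (X0 - τ * (y 0 * p + y 1 * q))| ≤ ‖y‖ * (ε * (τ * ‖y‖)) := by
        rw [abs_mul]; exact mul_le_mul ha0 e0 (abs_nonneg _) (norm_nonneg _)
      have h4 := (abs_le.1 h3).1
      have h5 : y 0 * (X0 - τ * (y 0 * p + y 1 * q)) = y 0 * X0 - y 0 * (τ * (y 0 * p + y 1 * q)) := by ring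
      linarith
    have k1 : y 1 * (τ * (y 0 * q + y 1 * r)) - ‖y‖ * (ε * (τ * ‖y‖)) ≤ y 1 * X1 := by
      have h3 : |y 1 * (X1 - τ * (y 0 * q + y 1 * r))| ≤ ‖y‖ * (ε * (τ * ‖y‖)) := by
        rw [abs_mul]; exact mul_le_mul ha1 e1 (abs_nonneg _) (norm_nonneg _)
      have h4 := (abs_le.1 h3).1
      have h5 : y 1 * (X1 - τ * (y 0 * q + y 1 * r)) = y 1 * X1 - y 1 * (τ * (y 0 * q + y 1 * r)) := by ring
      linarith
    have hsum : y 0 * (τ * (y 0 * p + y 1 * q)) + y 1 * (τ * (y 0 * q + y 1 * r)) =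
        τ * (p * y 0 ^ 2 + 2 * q * y 0 * y 1 + r * y 1 ^ 2) := by ring
    have hB : ‖y‖ * (ε * (τ * ‖y‖)) = lam / 8 * (τ * ‖y‖ ^ 2) := by rw [hε_def]; ring
    have hτQ : τ * (lam * ‖y‖ ^ 2) ≤ τ * (p * y 0 ^ 2 + 2 * q * y 0 * y 1 + r * y 1 ^ 2) :=
      mul_le_mul_of_nonneg_left hQy hτ0
    have hτQ' : τ * (lam * ‖y‖ ^ 2) = lam * (τ * ‖y‖ ^ 2) := by ring
    linarith
  -- comparison function `K τ = G τ − (3λ/8)|y|² τ²` is monotone on `[0,1]`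
  set K : ℝ → ℝ := fun τ => G τ - 3 * lam / 8 * ‖y‖ ^ 2 * τ ^ 2 with hK
  have hKd : ∀ τ, HasDerivAt K (fderiv ℝ g (τ • y) y - 3 * lam / 8 * ‖y‖ ^ 2 * (2 * τ)) τ := fun τ => by
    have h2 : HasDerivAt (fun τ : ℝ => 3 * lam / 8 * ‖y‖ ^ 2 * τ ^ 2) (3 * lam / 8 * ‖y‖ ^ 2 * (2 * τ)) τ := by
      have := (hasDerivAt_pow 2 τ).const_mul (3 * lam / 8 * ‖y‖ ^ 2)
      simpa using this
    exact (hGd τ).sub h2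
  have hmono : MonotoneOn K (Icc 0 1) :=
    monotoneOn_of_deriv_nonneg (convex_Icc 0 1) (fun τ _ => (hKd τ).continuousAt.continuousWithinAt)
      (fun τ _ => (hKd τ).differentiableAt.differentiableWithinAt) fun τ hτ => by
        rw [interior_Icc] at hτ
        rw [(hKd τ).deriv]
        have := hG' τ hτ.1.le hτ.2.le
        linarith
  have hK01 := hmono (left_mem_Icc.2 zero_le_one) (right_mem_Icc.2 zero_le_one) zero_le_one
  simp only [hK, hG, zero_smul, one_smul] at hK01
  have hpos : 0 < 3 * lam / 8 * ‖y‖ ^ 2 := by positivity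
  norm_num at hK01
  linarith

/-- **Definite horizontal Hessian ⇒ strict planar extremum** (`nhdsWithin` form of `NoPlanarExtremum`, base point `0`). -/
theorem strictPlanarExtremum_of_det_pos (hg : ContDiff ℝ 2 g)
    (h0 : fderiv ℝ g 0 (EuclideanSpace.single 0 1) = 0) (h1 : fderiv ℝ g 0 (EuclideanSpace.single 1 1) = 0)
    (hdet : 0 < fderiv ℝ (fun y => fderiv ℝ g y (EuclideanSpace.single 0 1)) 0 (EuclideanSpace.single 0 1) *
        fderiv ℝ (fun y => fderiv ℝ g y (EuclideanSpace.single 1 1)) 0 (EuclideanSpace.single 1 1) -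
      fderiv ℝ (fun y => fderiv ℝ g y (EuclideanSpace.single 0 1)) 0 (EuclideanSpace.single 1 1) *
        fderiv ℝ (fun y => fderiv ℝ g y (EuclideanSpace.single 1 1)) 0 (EuclideanSpace.single 0 1)) :
    (∀ᶠ y in nhdsWithin (0 : EuclideanSpace ℝ (Fin 3))
        {y | y 2 = (0 : EuclideanSpace ℝ (Fin 3)) 2 ∧ y ≠ 0}, g 0 < g y) ∨
      (∀ᶠ y in nhdsWithin (0 : EuclideanSpace ℝ (Fin 3))
        {y | y 2 = (0 : EuclideanSpace ℝ (Fin 3)) 2 ∧ y ≠ 0}, g y < g 0) := by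
  have hsym : fderiv ℝ (fun y => fderiv ℝ g y (EuclideanSpace.single 0 1)) 0 (EuclideanSpace.single 1 1) =
      fderiv ℝ (fun y => fderiv ℝ g y (EuclideanSpace.single 1 1)) 0 (EuclideanSpace.single 0 1) :=
    fderiv_fderiv_symm hg 0 _ _
  -- helper: ball statement ⇒ `nhdsWithin` statement
  have toEv : ∀ {P : EuclideanSpace ℝ (Fin 3) → Prop},
      (∃ ρ > 0, ∀ y : EuclideanSpace ℝ (Fin 3), y 2 = 0 → y ≠ 0 → ‖y‖ < ρ → P y) →
      ∀ᶠ y in nhdsWithin (0 : EuclideanSpace ℝ (Fin 3))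
        {y | y 2 = (0 : EuclideanSpace ℝ (Fin 3)) 2 ∧ y ≠ 0}, P y := by
    intro P ⟨ρ, hρ, hP⟩
    rw [eventually_nhdsWithin_iff, Metric.eventually_nhds_iff]
    refine ⟨ρ, hρ, fun y hy hmem => hP y ?_ hmem.2 (by rwa [dist_zero_right] at hy)⟩
    simpa using hmem.1
  rcases lt_trichotomy (fderiv ℝ (fun y => fderiv ℝ g y (EuclideanSpace.single 0 1)) 0 (EuclideanSpace.single 0 1)) 0
    with hneg | hzero | hpos
  · -- negative definite: apply the positive case to `-g`
    right
    have hng : ContDiff ℝ 2 (fun y => -g y) := hg.neg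
    have hfun : ∀ a : EuclideanSpace ℝ (Fin 3), (fun y => fderiv ℝ (fun z => -g z) y a) =
        fun y => -fderiv ℝ g y a := fun a => by
      funext y; rw [fderiv_fun_neg, _root_.neg_apply]
    have hn2 : ∀ a b : EuclideanSpace ℝ (Fin 3), fderiv ℝ (fun y => fderiv ℝ (fun z => -g z) y a) 0 b =
        -fderiv ℝ (fun y => fderiv ℝ g y a) 0 b := fun a b => by
      rw [hfun a, fderiv_fun_neg, _root_.neg_apply]
    have h0' : fderiv ℝ (fun z => -g z) 0 (EuclideanSpace.single 0 1) = 0 := by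
      rw [fderiv_fun_neg, _root_.neg_apply, h0, neg_zero]
    have h1' : fderiv ℝ (fun z => -g z) 0 (EuclideanSpace.single 1 1) = 0 := by
      rw [fderiv_fun_neg, _root_.neg_apply, h1, neg_zero]
    obtain ⟨ρ, hρ, hP⟩ := exists_ball_lt_of_posDef hng h0' h1' (by rw [hn2]; linarith)
      (by rw [hn2, hn2, hn2, hn2]; linarith)
    exact toEv ⟨ρ, hρ, fun y hy2 hy0 hyρ => by have := hP y hy2 hy0 hyρ; linarith⟩
  · exfalso
    rw [hzero, hsym, zero_mul, zero_sub] at hdet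
    nlinarith [sq_nonneg (fderiv ℝ (fun y => fderiv ℝ g y (EuclideanSpace.single 1 1)) 0 (EuclideanSpace.single 0 1))]
  · left
    exact toEv (exists_ball_lt_of_posDef hg h0 h1 hpos hdet)

/-! ### Part C at class level -/

/-- **PART C of Z1: a centre is a strict planar extremum of the stream function.**  For the slice `v(−1)` of a
poloidal profile of the route's Type-I class with the thread pin and the loop-tangency pins, if `det(H − M) > 0` then
there is a `C²` horizontal potential `Φ` (`v_h(−1,·) = ∇_hΦ`) such that `v₂(−1,·) − ∂₂Φ` has a strict local extremum
at `0` along the punctured plane `{y₂ = 0}` — conjunct (v) of `stub_threadZeroStructure`, in the `nhdsWithin` form of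
`LoopPeriodRatchet.NoPlanarExtremum`. -/
theorem centre_strictExtremum {C : ℝ} {v : ℝ → EuclideanSpace ℝ (Fin 3) → EuclideanSpace ℝ (Fin 3)}
    (hrate : HasTypeITimeDecay C v)
    (hcont : ContinuousOn (uncurry v) (Iio (0 : ℝ) ×ˢ univ))
    (hmild : ∀ s t : ℝ, s < t → t < 0 → ∀ x,
      v t x = UnboundedOperators.heatExtension (v s) (t - s) x - oseenDuhamel 1 s v v t x)
    (hdiv : ∀ t < 0, VectorCalculus.IsDivFree (v t))
    (hpol : ∀ s < 0, ∀ y, ⟪curl (v s) y, EuclideanSpace.single 2 1⟫_ℝ = 0)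
    (hgrad : ∀ h : EuclideanSpace ℝ (Fin 3), fderiv ℝ (v (-1)) 0 h 2 = 0)
    (hpin : fderiv ℝ (v (-1)) 0 (EuclideanSpace.single 2 1) 0 = 0 ∧
      fderiv ℝ (v (-1)) 0 (EuclideanSpace.single 2 1) 1 = 0)
    (hdet : 0 < (fderiv ℝ (fun x => fderiv ℝ (v (-1)) x (EuclideanSpace.single 0 1) 2) 0 (EuclideanSpace.single 0 1) -
            fderiv ℝ (fun x => fderiv ℝ (v (-1)) x (EuclideanSpace.single 2 1) 0) 0 (EuclideanSpace.single 0 1)) *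
          (fderiv ℝ (fun x => fderiv ℝ (v (-1)) x (EuclideanSpace.single 1 1) 2) 0 (EuclideanSpace.single 1 1) -
            fderiv ℝ (fun x => fderiv ℝ (v (-1)) x (EuclideanSpace.single 2 1) 1) 0 (EuclideanSpace.single 1 1)) -
          (fderiv ℝ (fun x => fderiv ℝ (v (-1)) x (EuclideanSpace.single 0 1) 2) 0 (EuclideanSpace.single 1 1) -
            fderiv ℝ (fun x => fderiv ℝ (v (-1)) x (EuclideanSpace.single 2 1) 0) 0 (EuclideanSpace.single 1 1)) *
          (fderiv ℝ (fun x => fderiv ℝ (v (-1)) x (EuclideanSpace.single 1 1) 2) 0 (EuclideanSpace.single 0 1) -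
            fderiv ℝ (fun x => fderiv ℝ (v (-1)) x (EuclideanSpace.single 2 1) 1) 0 (EuclideanSpace.single 0 1))) :
    ∃ Φ : EuclideanSpace ℝ (Fin 3) → ℝ, ContDiff ℝ 2 Φ ∧
      (∀ y, v (-1) y 0 = fderiv ℝ Φ y (EuclideanSpace.single 0 1) ∧
        v (-1) y 1 = fderiv ℝ Φ y (EuclideanSpace.single 1 1)) ∧
      ((∀ᶠ y in nhdsWithin (0 : EuclideanSpace ℝ (Fin 3)) {y | y 2 = (0 : EuclideanSpace ℝ (Fin 3)) 2 ∧ y ≠ 0},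
          v (-1) 0 2 - fderiv ℝ Φ 0 (EuclideanSpace.single 2 1) <
            v (-1) y 2 - fderiv ℝ Φ y (EuclideanSpace.single 2 1)) ∨
        (∀ᶠ y in nhdsWithin (0 : EuclideanSpace ℝ (Fin 3)) {y | y 2 = (0 : EuclideanSpace ℝ (Fin 3)) 2 ∧ y ≠ 0},
          v (-1) y 2 - fderiv ℝ Φ y (EuclideanSpace.single 2 1) <
            v (-1) 0 2 - fderiv ℝ Φ 0 (EuclideanSpace.single 2 1))) := by
  obtain ⟨φ, ψ, hφ2, hψ2, hcompφ, hsub, -, hψ0, hS0, hS1⟩ :=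
    clebsch_thread_package hrate hcont hmild hdiv hpol hgrad hpin
  rw [← hS0, ← hS0, ← hS1, ← hS1] at hdet
  have h0 : fderiv ℝ ψ 0 (EuclideanSpace.single 0 1) = 0 := by simpa using hψ0 1 0
  have h1 : fderiv ℝ ψ 0 (EuclideanSpace.single 1 1) = 0 := by simpa using hψ0 0 1
  refine ⟨φ, hφ2, hcompφ, ?_⟩
  simp only [hsub]
  exact strictPlanarExtremum_of_det_pos hψ2 h0 h1 hdet

end Summit.NavierStokesRegularity.NavierStokesRegularity.Theorems.PoloidalWindowDoorPoloidalWindowRigidityThreadCentreExtremum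

end
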